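import Mathlib

/-!
# p-closedness of the Király–Lütkebohmert residue operator (general GhostRationality)

(crux stmt-ResolutionOfSingularities-15640 `WildQuotients.WildQuotientResolution`, line `Sketch`,
registered worker stubs `residueSeq_eq_zero` and `residueOperator_charPoly_mem_sq` of lead
res-L1-w45c-lead-1, note `L/res-L1-w45c-lead-1/KL-RESIDUAL-FOLIATION.md` Theorem A; proved by
res-L1-w45c-stub-4.)

[OURS · L1 W4.5c] replaces the role of no printed item; NOT a statement of the manuscript.
`σ` is a ring endomorphism of a commutative ring `B` of characteristic `p` with `σ^[p] = id`,
`M ∈ B` a non-zero-divisor dividing every `σ b - b`, `θ = (σ - 1)/M` the residual map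
(`σ b - b = M * θ b`), TANGENCY `θ M = M * γ`.
(1) `residueSeq_eq_zero`: the exact cofactor recursion `k (j+1) = θ (k j) + c j * σ (k j)` with
`c j = ((1 + M γ)^j - 1)/M = ∑_{i<j} C(j,i+1) M^i γ^(i+1)` satisfies `(σ - 1)^[j] (k 0) = M^j * k j`,
hence `k p = 0`.
(2) `residueOperator_charPoly_mem_sq`: for an ideal `I ∋ M` with `θ I ⊆ I`, the first-order
recursion `h (j+1) = θ (h j) + j γ h j` from `h 0 ∈ I` ends in `h p ∈ I ^ 2`: on `I/I²` the residue
operator `L` induced by `θ` satisfies `∏_{j ∈ 𝔽_p} (L + j γ) = L^p - γ^(p-1) L = 0` — the analogue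
of the linear part of a `p`-closed vector field. The corner case is the landed `GhostRationality`
(stmt-17943).

References: F. Király, W. Lütkebohmert, *Group actions of prime order on local normal rings*,
Algebra & Number Theory 7 (2013), §4 (the pseudo-derivation `σ − 1`); the identities are folklore.
-/

-- single-problem summit: the doubled namespace component `ResolutionOfSingularities` is forced
set_option linter.dupNamespace false

namespace Summit.ResolutionOfSingularities.ResolutionOfSingularities.Theorems.WildQuotientResolution.ResidueOperator

open Finset

variable {B : Type} [CommRing B]

/-- **`(σ − 1)^[p] = 0`** for a ring endomorphism `σ` of a ring of prime characteristic `p` with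
`σ^[p] = id` (pointwise): in the ring of additive (`ℤ`-linear) endomorphisms of `B`, which has
characteristic `p`, `(σ − 1)^p = σ^p − 1 = 0`. (Route-independent restatement for ring
ENDOmorphisms of `WildQuotients.GhostRationality.iterate_sub_self_eq_zero`, which is stated for
ring automorphisms; the characteristic of `Module.End ℤ B` is re-derived inline so that this file
imports no route file.) [folklore; Király–Lütkebohmert 2013 §4] -/
theorem iterate_sub_self_eq_zero_of_iterate_eq (p : ℕ) [Fact p.Prime] [CharP B p] (σ : B →+* B)
    (hσ : ∀ b : B, (⇑σ)^[p] b = b) (b : B) : (fun y => σ y - y)^[p] b = 0 := by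
  haveI : CharP (Module.End ℤ B) p := by
    refine ⟨fun n => ?_⟩
    rw [← CharP.cast_eq_zero_iff B p n]
    constructor
    · intro h
      have := congrArg (fun f : Module.End ℤ B => f 1) h
      simpa [Module.End.natCast_apply] using this
    · intro h
      ext x
      rw [Module.End.natCast_apply, LinearMap.zero_apply, nsmul_eq_mul, h, zero_mul]
  let L : Module.End ℤ B := σ.toAddMonoidHom.toIntLinearMap
  have hL : ∀ y, L y = σ y := fun y => rfl
  have hcomm : Commute L 1 := Commute.one_right L
  have hpow : ∀ (n : ℕ) (y : B), (L ^ n) y = (⇑σ)^[n] y := by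
    intro n
    induction n with
    | zero => intro y; simp
    | succ n ih =>
      intro y
      rw [pow_succ', Module.End.mul_apply, ih, hL, Function.iterate_succ_apply']
  have hLp : L ^ p = 1 := by
    ext y
    rw [hpow, hσ, Module.End.one_apply]
  have hsub : (L - 1) ^ p = 0 := by
    rw [sub_pow_char_of_commute (p := p) hcomm, hLp, one_pow, sub_self]
  have hiter : ∀ (n : ℕ) (y : B), ((L - 1) ^ n) y = (fun y => σ y - y)^[n] y := by
    intro n
    induction n with
    | zero => intro y; simp
    | succ n ih =>
      intro y
      rw [pow_succ', Module.End.mul_apply, ih, Function.iterate_succ_apply', LinearMap.sub_apply,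
        Module.End.one_apply, hL]
  rw [← hiter, hsub, LinearMap.zero_apply]

/-- A non-zero-divisor `M` has non-zero-divisor powers: `M ^ n * b = 0 → b = 0`. [folklore] -/
theorem eq_zero_of_pow_mul_eq_zero (M : B) (hM : ∀ b : B, M * b = 0 → b = 0) (n : ℕ) (b : B)
    (hb : M ^ n * b = 0) : b = 0 := by
  induction n generalizing b with
  | zero => simpa using hb
  | succ n ih =>
    rw [pow_succ, mul_assoc] at hb
    exact hM b (ih _ hb)

/-- The cofactor identity `M * c j = (1 + M γ)^j − 1` for
`c j = ∑_{i<j} C(j,i+1) M^i γ^(i+1)` (binomial theorem). [folklore] -/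
theorem mul_cofactorSum_eq (M γ : B) (j : ℕ) :
    M * (∑ i ∈ Finset.range j, ((j.choose (i + 1) : ℕ) : B) * M ^ i * γ ^ (i + 1)) =
      (1 + M * γ) ^ j - 1 := by
  rw [add_comm (1 : B), add_pow, Finset.sum_range_succ', Finset.mul_sum]
  simp only [one_pow, mul_one, pow_zero, Nat.choose_zero_right, Nat.cast_one, add_sub_cancel_right]
  exact Finset.sum_congr rfl fun i _ => by ring

/-- **Registered stub `residueSeq_eq_zero`** (Theorem A, exact form). With `D := σ − 1`,
`σ M = M * (1 + M γ)` (tangency), so `D (M^j * h) = M^j * (((1 + M γ)^j − 1) * σ h + M * θ h)`;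
hence by induction `D^[j] (k 0) = M ^ j * k j` for the recursion
`k (j+1) = θ (k j) + c j * σ (k j)`, `c j = ∑_{i<j} C(j,i+1) M^i γ^(i+1) = ((1 + M γ)^j − 1)/M`.
Since `D^[p] = 0` in characteristic `p` (`iterate_sub_self_eq_zero_of_iterate_eq`) and `M` is a
non-zero-divisor, `k p = 0`. [OURS · L1 W4.5c; folklore; Király–Lütkebohmert 2013 §4 for the
corner case] -/
theorem residueSeq_eq_zero {B : Type} [CommRing B] (p : ℕ) [Fact p.Prime] [CharP B p]
    (σ : B →+* B) (hσ : ∀ b : B, (⇑σ)^[p] b = b) (M γ : B) (hM : ∀ b : B, M * b = 0 → b = 0)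
    (θ : B → B) (hθ : ∀ b : B, σ b - b = M * θ b) (hγ : θ M = M * γ) (k : ℕ → B)
    (hk : ∀ j : ℕ, k (j + 1) = θ (k j) +
      (∑ i ∈ Finset.range j, ((j.choose (i + 1) : ℕ) : B) * M ^ i * γ ^ (i + 1)) * σ (k j)) :
    k p = 0 := by
  -- tangency: `σ M = M (1 + M γ)`
  have hσM : σ M = M * (1 + M * γ) := by
    have h := hθ M
    rw [hγ] at h
    linear_combination h
  -- the key identity `(σ - 1)^[j] (k 0) = M ^ j * k j`
  have hD : ∀ j : ℕ, (fun y => σ y - y)^[j] (k 0) = M ^ j * k j := by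
    intro j
    induction j with
    | zero => simp
    | succ j ih =>
      rw [Function.iterate_succ_apply', ih, map_mul, map_pow, hσM, hk j, mul_pow]
      linear_combination (M ^ j) * hθ (k j) - (M ^ j * σ (k j)) * mul_cofactorSum_eq M γ j
  have hp : M ^ p * k p = 0 := by
    rw [← hD p]
    exact iterate_sub_self_eq_zero_of_iterate_eq p σ hσ (k 0)
  exact eq_zero_of_pow_mul_eq_zero M hM p (k p) hp

/-- The residual map `θ = (σ − 1)/M` is uniquely determined (`M` a non-zero-divisor), hence
additive. [folklore] -/
theorem residual_add (σ : B →+* B) (M : B) (hM : ∀ b : B, M * b = 0 → b = 0) (θ : B → B)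
    (hθ : ∀ b : B, σ b - b = M * θ b) (a b : B) : θ (a + b) = θ a + θ b := by
  have h : M * (θ (a + b) - (θ a + θ b)) = 0 := by
    rw [mul_sub, mul_add, ← hθ, ← hθ, ← hθ, map_add]
    ring
  exact sub_eq_zero.mp (hM _ h)

/-- The residual map `θ = (σ − 1)/M` commutes with subtraction. [folklore] -/
theorem residual_sub (σ : B →+* B) (M : B) (hM : ∀ b : B, M * b = 0 → b = 0) (θ : B → B)
    (hθ : ∀ b : B, σ b - b = M * θ b) (a b : B) : θ (a - b) = θ a - θ b := by
  have h : M * (θ (a - b) - (θ a - θ b)) = 0 := by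
    rw [mul_sub, mul_sub, ← hθ, ← hθ, ← hθ, map_sub]
    ring
  exact sub_eq_zero.mp (hM _ h)

/-- Twisted Leibniz rule of the residual map: `θ (a b) = θ a · b + a · θ b + M · θ a · θ b`
(`θ` is a derivation modulo `M`). [folklore; Király–Lütkebohmert 2013 §4] -/
theorem residual_mul (σ : B →+* B) (M : B) (hM : ∀ b : B, M * b = 0 → b = 0) (θ : B → B)
    (hθ : ∀ b : B, σ b - b = M * θ b) (a b : B) :
    θ (a * b) = θ a * b + a * θ b + M * θ a * θ b := by
  have ha : σ a = a + M * θ a := by linear_combination hθ a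
  have hb : σ b = b + M * θ b := by linear_combination hθ b
  have hab := hθ (a * b)
  rw [map_mul, ha, hb] at hab
  have h : M * (θ (a * b) - (θ a * b + a * θ b + M * θ a * θ b)) = 0 := by
    linear_combination -hab
  exact sub_eq_zero.mp (hM _ h)

/-- The residual map preserves `I ^ 2` for every ideal `I` with `θ I ⊆ I` (twisted Leibniz
rule + additivity; `M ∈ I` is not even needed). [folklore] -/
theorem residual_mem_sq (σ : B →+* B) (M : B) (hM : ∀ b : B, M * b = 0 → b = 0) (θ : B → B)
    (hθ : ∀ b : B, σ b - b = M * θ b) (I : Ideal B) (hθI : ∀ b ∈ I, θ b ∈ I)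
    (x : B) (hx : x ∈ I ^ 2) : θ x ∈ I ^ 2 := by
  rw [pow_two] at hx ⊢
  refine Submodule.mul_induction_on hx ?_ ?_
  · intro a ha b hb
    rw [residual_mul σ M hM θ hθ]
    refine Ideal.add_mem _ (Ideal.add_mem _ ?_ ?_) ?_
    · exact Ideal.mul_mem_mul (hθI a ha) hb
    · exact Ideal.mul_mem_mul ha (hθI b hb)
    · exact Ideal.mul_mem_mul (I.mul_mem_left M (hθI a ha)) (hθI b hb)
  · intro x y hx hy
    rw [residual_add σ M hM θ hθ]
    exact Ideal.add_mem _ hx hy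

/-- The cofactor `c j = ∑_{i<j} C(j,i+1) M^i γ^(i+1)` is `j γ` modulo `M`: `c j − j γ ∈ I` for any
ideal `I ∋ M`. [folklore] -/
theorem cofactorSum_sub_mem (M γ : B) (I : Ideal B) (hMI : M ∈ I) (j : ℕ) :
    (∑ i ∈ Finset.range j, ((j.choose (i + 1) : ℕ) : B) * M ^ i * γ ^ (i + 1)) - (j : B) * γ ∈ I := by
  rw [← Ideal.Quotient.eq_zero_iff_mem, map_sub, map_sum]
  have hM0 : Ideal.Quotient.mk I M = 0 := Ideal.Quotient.eq_zero_iff_mem.mpr hMI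
  simp only [map_mul, map_pow, map_natCast, hM0]
  rw [Finset.sum_eq_single 0]
  · simp
  · intro i _ hi
    simp [zero_pow hi]
  · intro h0
    have hj : j = 0 := by simpa using h0
    subst hj
    simp

/-- **Registered stub `residueOperator_charPoly_mem_sq`** (Theorem A on the cotangent module of
any ideal `I ∋ M` stable under `θ`): the first-order recursion `h (j+1) = θ (h j) + j γ h j` from
`h 0 ∈ I` satisfies `h p ∈ I ^ 2`. Proof: compare with the exact recursion `k` of
`residueSeq_eq_zero` started at `k 0 = h 0`: `θ` is additive and `θ (I²) ⊆ I²`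
(`residual_mem_sq`), `c j − j γ ∈ M B ⊆ I` (`cofactorSum_sub_mem`), `σ x − x = M θ x ∈ I²` for
`x ∈ I`; so `h j − k j ∈ I²` for all `j`, and `k p = 0`. On `I/I²` this says that the residue
operator `L` induced by `θ` satisfies `∏_{j ∈ 𝔽_p} (L + j γ) = 0`. [OURS · L1 W4.5c; folklore] -/
theorem residueOperator_charPoly_mem_sq {B : Type} [CommRing B] (p : ℕ) [Fact p.Prime] [CharP B p]
    (σ : B →+* B) (hσ : ∀ b : B, (⇑σ)^[p] b = b) (M γ : B) (hM : ∀ b : B, M * b = 0 → b = 0)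
    (θ : B → B) (hθ : ∀ b : B, σ b - b = M * θ b) (hγ : θ M = M * γ)
    (I : Ideal B) (hMI : M ∈ I) (hθI : ∀ b ∈ I, θ b ∈ I) (h : ℕ → B) (h0 : h 0 ∈ I)
    (hh : ∀ j : ℕ, h (j + 1) = θ (h j) + (j : B) * γ * h j) :
    h p ∈ I ^ 2 := by
  -- the cofactors and the exact companion sequence `k`, `k 0 = h 0`
  obtain ⟨c, hc⟩ : ∃ c : ℕ → B, ∀ j : ℕ,
      c j = ∑ i ∈ Finset.range j, ((j.choose (i + 1) : ℕ) : B) * M ^ i * γ ^ (i + 1) :=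
    ⟨_, fun j => rfl⟩
  obtain ⟨k, hk0, hk⟩ : ∃ k : ℕ → B, k 0 = h 0 ∧ ∀ j : ℕ, k (j + 1) = θ (k j) + c j * σ (k j) :=
    ⟨fun j => Nat.rec (h 0) (fun j kj => θ kj + c j * σ kj) j, rfl, fun j => rfl⟩
  have hkp : k p = 0 :=
    residueSeq_eq_zero p σ hσ M γ hM θ hθ hγ k (fun j => by rw [hk, hc])
  -- every `h j` and `k j` lies in `I`
  have hhI : ∀ j : ℕ, h j ∈ I := by
    intro j
    induction j with
    | zero => exact h0
    | succ j ih =>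
      rw [hh]
      exact I.add_mem (hθI _ ih) (I.mul_mem_left _ ih)
  have hkI : ∀ j : ℕ, k j ∈ I := by
    intro j
    induction j with
    | zero => rw [hk0]; exact h0
    | succ j ih =>
      rw [hk]
      have hσk : σ (k j) = k j + M * θ (k j) := by linear_combination hθ (k j)
      refine I.add_mem (hθI _ ih) (I.mul_mem_left _ ?_)
      rw [hσk]
      exact I.add_mem ih (I.mul_mem_left _ (hθI _ ih))
  -- the comparison `h j - k j ∈ I ^ 2`
  have hdiff : ∀ j : ℕ, h j - k j ∈ I ^ 2 := by
    intro j
    induction j with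
    | zero => rw [hk0, sub_self]; exact Ideal.zero_mem _
    | succ j ih =>
      rw [hh, hk]
      have e : θ (h j) + (j : B) * γ * h j - (θ (k j) + c j * σ (k j)) =
          θ (h j - k j) - (c j - (j : B) * γ) * h j + c j * (h j - k j)
            - c j * (M * θ (k j)) := by
        linear_combination - residual_sub σ M hM θ hθ (h j) (k j) - (c j) * hθ (k j)
      rw [e]
      refine Ideal.sub_mem _ (Ideal.add_mem _ (Ideal.sub_mem _
        (residual_mem_sq σ M hM θ hθ I hθI _ ih) ?_) (Ideal.mul_mem_left _ _ ih)) ?_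
      · rw [pow_two]
        refine Ideal.mul_mem_mul ?_ (hhI j)
        rw [hc]
        exact cofactorSum_sub_mem M γ I hMI j
      · rw [pow_two]
        exact Ideal.mul_mem_left _ _ (Ideal.mul_mem_mul hMI (hθI _ (hkI j)))
  have hfin := hdiff p
  rwa [hkp, sub_zero] at hfin

end Summit.ResolutionOfSingularities.ResolutionOfSingularities.Theorems.WildQuotientResolution.ResidueOperator
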